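import Summits.AtomisticToContinuum.HydrodynamicLimit.Theorems.InformationPercolationEnginePercolationClosesChaosForecastTransferArch
import Summits.AtomisticToContinuum.HydrodynamicLimit.Theorems.InformationPercolationEnginePercolationClosesChaosRevealedDictionary
import Summits.AtomisticToContinuum.HydrodynamicLimit.Theorems.InformationPercolationEnginePercolationClosesChaosRevealedDefectFacts
import HarnessLib

/-!
# Forecast transfer S6 of the line `equilibrium-forecast-chain-rule` (crux `InformationPercolationEngine.PercolationClosesChaos`,
stmt-AtomisticToContinuum-15178) — piece H4: `RevealedDefectStability → RevealedSandwich`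

Support file (`--supports stmt-AtomisticToContinuum-15178`) of the registered helper `revealedSandwich_of` (worker W3 of lead c3):
the fourth hypothesis `RevealedSandwich` of the architecture `kineticCellChaosLG_of` (piece A, `…ForecastTransferArch`) follows
from the item-class input `RevealedDefectStability` (`…ForecastStatements`) and the revealed dictionary of piece H4/D
(`ownedCount_eq_of_seqHistLE_eq`, `…RevealedDictionary`: on the good set the owned count of a unit is a function of the data
revealed right after it).

The construction, for one particle number `N`, flow `Φ`, bin width `b` and level `T` (atom of `z` for the unit `(k, q)`:
`A = Φ.good ∩ {z' | seqHistLE b c σ N Φ k q z' = seqHistLE b c σ N Φ k q z}`; `bW_η = badWeight Ψ η T`):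

* REVEALED MAJORANT `X k q z := sSup (bW_η k q '' A)` for `q` in the box, `0` off the box;
* REVEALED REMAINDER `R k q z := max 0 (X k q z − sInf (bW_{η/2} k q '' A))` for `q` in the box, `0` off the box.

Both depend on `z` only through its atom (revealed), take values in `[0, T]` (`Real.sSup_le`, `Real.sInf_nonneg`), and on
the good set `bW_η z ≤ X z` (`le_csSup`, `z ∈ A`) and `X z ≤ bW_{η/2} z + R z` (`csInf_le`) hold trivially. The content is the
pointwise bound `R z ≤ min(ownedCount z, T) · 𝟙{η/4 < defectOsc z}` on the good set (`revealedRemainder_le_integrand`): by the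
dictionary `bW_η' z' = m 𝟙{η' < unitDefect z'}` with the SAME `m = min(ownedCount z, T)` for every `z' ∈ A`, so `R z > 0` forces a
point of the atom with `unitDefect > η` and one with `unitDefect ≤ η/2`, whence `defectOsc z > η/4` (the two-point oscillation bound
`abs_unitDefect_sub_le_two_mul_defectOsc` of `…RevealedDefectFacts`). Integrating (`LG(goodᶜ) = 0`, `unitAvg` monotone on box-supported
families, Bochner `≤` lower integral for the nonnegative `unitAvg R`) turns `RevealedDefectStability` at `(Ψ, η/4, δ₄, T)` into
`unitMean R ≤ δ₄`; its quantifier prefix `∃ c₀ ∀ c ∃ b₀ ∀ b ≤ b₀ ∃ N₀` is threaded through verbatim, with `σ₀ := min(σ₀, 1/2)`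
for the regular geometry the dictionary needs.
-/

noncomputable section

open MeasureTheory Set Filter Topology
open scoped ENNReal BigOperators Classical
open Literature.Analysis.FluidPDE Literature.MathematicalPhysics.KineticTheory
open Literature.MathematicalPhysics.KineticTheory.VelocityBlindPlacement

namespace Summit.AtomisticToContinuum.HydrodynamicLimit.Theorems.EquilibriumForecastLine

section OneN

variable {σ : ℝ} {N : ℕ} (Φ : Flow σ N)

/-! ## The remainder of an atom is paid by `RevealedDefectStability`'s integrand -/

/-- **The heart of H4.** On the good set (`0 < c`, `0 < σ < 1/2`, `0 ≤ T`, any `η`), with `A` the revealed atom of `z` for the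
unit `(k, q)` cut to the good set:
`max 0 (sSup (bW_η '' A) − sInf (bW_{η/2} '' A)) ≤ min(ownedCount z, T) · 𝟙{η/4 < defectOsc z}`.
By the dictionary every `z' ∈ A` has `bW_{η'} z' = m · 𝟙{η' < unitDefect z'}` with the same `m = min(ownedCount z, T)`; so the
left side is `≤ m`, and it is positive only if some `z₁ ∈ A` has `unitDefect z₁ > η` and some `z₂ ∈ A` has `unitDefect z₂ ≤ η/2`,
in which case `η/2 < |unitDefect z₁ − unitDefect z₂| ≤ 2 defectOsc z`. [folklore] -/
theorem revealedRemainder_le_integrand {z : Phase N} (hz : z ∈ Φ.good) {Ψ : V3 × V3 × V3 → ℝ} (hΨc : Continuous Ψ) {CΨ : ℝ}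
    (hΨ : ∀ p, |Ψ p| ≤ CΨ) {c : ℝ} (hc : 0 < c) (hσ : 0 < σ) (hσ2 : σ < 2⁻¹) (b : ℝ) (η : ℝ) {T : ℝ} (hT : 0 ≤ T)
    (k : ℕ) (q : Cell) :
    max 0 (sSup ((fun z' => badWeight Ψ η T c σ N Φ k q z') ''
          (Φ.good ∩ {z' | seqHistLE b c σ N Φ k q z' = seqHistLE b c σ N Φ k q z})) -
        sInf ((fun z' => badWeight Ψ (η / 2) T c σ N Φ k q z') ''
          (Φ.good ∩ {z' | seqHistLE b c σ N Φ k q z' = seqHistLE b c σ N Φ k q z}))) ≤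
      min (ownedCount c σ N Φ k q z) T * (if η / 4 < defectOsc Ψ b c σ N Φ k q z then 1 else 0) := by
  set A := Φ.good ∩ {z' | seqHistLE b c σ N Φ k q z' = seqHistLE b c σ N Φ k q z} with hA
  set m := min (ownedCount c σ N Φ k q z) T with hm
  have hzA : z ∈ A := ⟨hz, rfl⟩
  have hm0 : 0 ≤ m := le_min (ownedCount_nonneg hc.le hσ Φ k q z) hT
  -- the dictionary: one and the same truncated owned count all over the atom
  have hval : ∀ (η' : ℝ), ∀ z' ∈ A,
      badWeight Ψ η' T c σ N Φ k q z' = m * (if η' < unitDefect Ψ c σ N Φ k q z' then 1 else 0) := by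
    intro η' z' hz'
    unfold badWeight
    rw [ownedCount_eq_of_seqHistLE_eq Φ b c k q hz hz'.1 hc hσ hσ2 hz'.2]
  have hS : ∀ (η' : ℝ), ∀ x ∈ (fun z' => badWeight Ψ η' T c σ N Φ k q z') '' A, 0 ≤ x ∧ x ≤ m := by
    rintro η' _ ⟨z', hz', rfl⟩
    dsimp only
    rw [hval η' z' hz']
    split_ifs
    · rw [mul_one]; exact ⟨hm0, le_rfl⟩
    · rw [mul_zero]; exact ⟨le_rfl, hm0⟩
  have hsup_le : sSup ((fun z' => badWeight Ψ η T c σ N Φ k q z') '' A) ≤ m :=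
    Real.sSup_le (fun x hx => (hS η x hx).2) hm0
  have hinf_ge : 0 ≤ sInf ((fun z' => badWeight Ψ (η / 2) T c σ N Φ k q z') '' A) :=
    Real.sInf_nonneg (fun x hx => (hS (η / 2) x hx).1)
  by_cases hosc : η / 4 < defectOsc Ψ b c σ N Φ k q z
  · rw [if_pos hosc, mul_one]
    exact max_le hm0 (by linarith)
  · rw [if_neg hosc, mul_zero]
    refine max_le le_rfl (sub_nonpos.2 (not_lt.1 fun hlt => hosc ?_))
    -- a point of the atom with a large defect
    obtain ⟨z₁, hz₁, hη₁⟩ : ∃ z₁ ∈ A, η < unitDefect Ψ c σ N Φ k q z₁ := by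
      by_contra hno
      have hno' : ∀ z₁ ∈ A, ¬ η < unitDefect Ψ c σ N Φ k q z₁ := fun z₁ hz₁ h => hno ⟨z₁, hz₁, h⟩
      have hle : sSup ((fun z' => badWeight Ψ η T c σ N Φ k q z') '' A) ≤ 0 := by
        refine Real.sSup_nonpos ?_
        rintro _ ⟨z', hz', rfl⟩
        dsimp only
        rw [hval η z' hz', if_neg (hno' z' hz'), mul_zero]
      linarith
    -- and one with a small defect
    obtain ⟨z₂, hz₂, hη₂⟩ : ∃ z₂ ∈ A, ¬ η / 2 < unitDefect Ψ c σ N Φ k q z₂ := by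
      by_contra hno
      have hno' : ∀ z₂ ∈ A, η / 2 < unitDefect Ψ c σ N Φ k q z₂ :=
        fun z₂ hz₂ => not_not.1 fun h => hno ⟨z₂, hz₂, h⟩
      have hle : m ≤ sInf ((fun z' => badWeight Ψ (η / 2) T c σ N Φ k q z') '' A) := by
        refine le_csInf ⟨_, z, hzA, rfl⟩ ?_
        rintro _ ⟨z', hz', rfl⟩
        dsimp only
        rw [hval (η / 2) z' hz', if_pos (hno' z' hz'), mul_one]
      linarith
    -- their defects differ by more than `η/2`, so the oscillation at `z` exceeds `η/4`
    have h3 := abs_unitDefect_sub_le_two_mul_defectOsc Φ hΨc hΨ hc hσ b k q hz₁.1 hz₂.1 hz₁.2 hz₂.2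
    have h4 := le_abs_self (unitDefect Ψ c σ N Φ k q z₁ - unitDefect Ψ c σ N Φ k q z₂)
    have h5 := not_lt.1 hη₂
    linarith

/-! ## The revealed majorant and remainder of one particle number -/

/-- **The revealed pair of one `N`.** For a flow `Φ`, `0 < σ < 1/2`, `0 < c`, a bin width `b`, a bounded continuous `Ψ`,
any `η`, `T > 0`, a horizon `τ` and a law `μ` with `μ(goodᶜ) = 0` under which `RevealedDefectStability`'s integrand at
`(Ψ, η/4, T)` has lower integral `≤ δ`: the families `X` (revealed majorant) and `R` (revealed remainder) of the module docstring
satisfy the nine clauses of `RevealedSandwich` for this `N`. [folklore] -/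
theorem exists_revealedMajorant_remainder (hσ : 0 < σ) (hσ2 : σ < 2⁻¹) {c : ℝ} (hc : 0 < c) (b : ℝ) {Ψ : V3 × V3 × V3 → ℝ}
    (hΨc : Continuous Ψ) {CΨ : ℝ} (hΨ : ∀ p, |Ψ p| ≤ CΨ) (η : ℝ) {T : ℝ} (hT : 0 < T) (τ : ℝ)
    (μ : Measure (Phase N)) (hμ : μ Φ.goodᶜ = 0) {δ : ℝ} (hδ : 0 ≤ δ)
    (hint : ∫⁻ z, ENNReal.ofReal (unitAvg c σ N τ fun k q =>
        min (ownedCount c σ N Φ k q z) T * (if η / 4 < defectOsc Ψ b c σ N Φ k q z then 1 else 0)) ∂μ ≤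
      ENNReal.ofReal δ) :
    ∃ X R : ℕ → Cell → Phase N → ℝ,
      (∀ k q z, 0 ≤ X k q z ∧ X k q z ≤ T) ∧ (∀ k q z, 0 ≤ R k q z ∧ R k q z ≤ T) ∧
      (∀ k, ∀ q ∉ cellBox (c * meanFreePath σ N), X k q = fun _ => 0) ∧
      (∀ k, ∀ q ∉ cellBox (c * meanFreePath σ N), R k q = fun _ => 0) ∧
      (∀ k q, q ∈ cellBox (c * meanFreePath σ N) → ∀ z z',
        seqHistLE b c σ N Φ k q z = seqHistLE b c σ N Φ k q z' → X k q z = X k q z') ∧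
      (∀ k q, q ∈ cellBox (c * meanFreePath σ N) → ∀ z z',
        seqHistLE b c σ N Φ k q z = seqHistLE b c σ N Φ k q z' → R k q z = R k q z') ∧
      (∀ k q, ∀ z ∈ Φ.good, badWeight Ψ η T c σ N Φ k q z ≤ X k q z) ∧
      (∀ k q, ∀ z ∈ Φ.good, X k q z ≤ badWeight Ψ (η / 2) T c σ N Φ k q z + R k q z) ∧
      unitMean c σ N τ μ R ≤ δ := by
  have hh : 0 < c * meanFreePath σ N := mul_pos hc (meanFreePath_pos hσ N)
  -- the two families, through their defining equations
  obtain ⟨X, hX⟩ : ∃ X : ℕ → Cell → Phase N → ℝ, ∀ k q z, X k q z =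
      if q ∈ cellBox (c * meanFreePath σ N) then
        sSup ((fun z' => badWeight Ψ η T c σ N Φ k q z') ''
          (Φ.good ∩ {z' | seqHistLE b c σ N Φ k q z' = seqHistLE b c σ N Φ k q z})) else 0 :=
    ⟨_, fun _ _ _ => rfl⟩
  obtain ⟨R, hR⟩ : ∃ R : ℕ → Cell → Phase N → ℝ, ∀ k q z, R k q z =
      if q ∈ cellBox (c * meanFreePath σ N) then
        max 0 (sSup ((fun z' => badWeight Ψ η T c σ N Φ k q z') ''
            (Φ.good ∩ {z' | seqHistLE b c σ N Φ k q z' = seqHistLE b c σ N Φ k q z})) -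
          sInf ((fun z' => badWeight Ψ (η / 2) T c σ N Φ k q z') ''
            (Φ.good ∩ {z' | seqHistLE b c σ N Φ k q z' = seqHistLE b c σ N Φ k q z}))) else 0 :=
    ⟨_, fun _ _ _ => rfl⟩
  -- elementary bounds of the two images
  have hbW : ∀ (η' : ℝ) k q z, 0 ≤ badWeight Ψ η' T c σ N Φ k q z ∧ badWeight Ψ η' T c σ N Φ k q z ≤ T := by
    intro η' k q z
    refine ⟨badWeight_nonneg hc.le hσ Ψ η' hT.le Φ k q z, ?_⟩
    unfold badWeight
    split_ifs
    · rw [mul_one]; exact min_le_right _ _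
    · rw [mul_zero]; exact hT.le
  have hsup : ∀ k q z, 0 ≤ sSup ((fun z' => badWeight Ψ η T c σ N Φ k q z') ''
      (Φ.good ∩ {z' | seqHistLE b c σ N Φ k q z' = seqHistLE b c σ N Φ k q z})) ∧
      sSup ((fun z' => badWeight Ψ η T c σ N Φ k q z') ''
      (Φ.good ∩ {z' | seqHistLE b c σ N Φ k q z' = seqHistLE b c σ N Φ k q z})) ≤ T := by
    intro k q z
    refine ⟨Real.sSup_nonneg ?_, Real.sSup_le ?_ hT.le⟩
    · rintro _ ⟨z', -, rfl⟩; exact (hbW η k q z').1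
    · rintro _ ⟨z', -, rfl⟩; exact (hbW η k q z').2
  have hinf : ∀ k q z, 0 ≤ sInf ((fun z' => badWeight Ψ (η / 2) T c σ N Φ k q z') ''
      (Φ.good ∩ {z' | seqHistLE b c σ N Φ k q z' = seqHistLE b c σ N Φ k q z})) := by
    intro k q z
    refine Real.sInf_nonneg ?_
    rintro _ ⟨z', -, rfl⟩; exact (hbW (η / 2) k q z').1
  -- the clauses
  have hXb : ∀ k q z, 0 ≤ X k q z ∧ X k q z ≤ T := by
    intro k q z
    rw [hX]
    split_ifs
    · exact hsup k q z
    · exact ⟨le_rfl, hT.le⟩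
  have hRb : ∀ k q z, 0 ≤ R k q z ∧ R k q z ≤ T := by
    intro k q z
    rw [hR]
    split_ifs
    · refine ⟨le_max_left _ _, max_le hT.le ?_⟩
      linarith [(hsup k q z).2, hinf k q z]
    · exact ⟨le_rfl, hT.le⟩
  have hX0 : ∀ k, ∀ q ∉ cellBox (c * meanFreePath σ N), X k q = fun _ => 0 := by
    intro k q hq; funext z; rw [hX, if_neg hq]
  have hR0 : ∀ k, ∀ q ∉ cellBox (c * meanFreePath σ N), R k q = fun _ => 0 := by
    intro k q hq; funext z; rw [hR, if_neg hq]
  have hXa : ∀ k q, q ∈ cellBox (c * meanFreePath σ N) → ∀ z z',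
      seqHistLE b c σ N Φ k q z = seqHistLE b c σ N Φ k q z' → X k q z = X k q z' := by
    intro k q _ z z' hzz'
    rw [hX, hX, hzz']
  have hRa : ∀ k q, q ∈ cellBox (c * meanFreePath σ N) → ∀ z z',
      seqHistLE b c σ N Φ k q z = seqHistLE b c σ N Φ k q z' → R k q z = R k q z' := by
    intro k q _ z z' hzz'
    rw [hR, hR, hzz']
  have hdom : ∀ k q, ∀ z ∈ Φ.good, badWeight Ψ η T c σ N Φ k q z ≤ X k q z := by
    intro k q z hz
    by_cases hq : q ∈ cellBox (c * meanFreePath σ N)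
    · rw [hX, if_pos hq]
      refine le_csSup ⟨T, ?_⟩ ⟨z, ⟨hz, rfl⟩, rfl⟩
      rintro _ ⟨z', -, rfl⟩; exact (hbW η k q z').2
    · rw [hX, if_neg hq, badWeight_eq_zero_of_not_mem hh Ψ η hT.le Φ k hq z]
  have hsand : ∀ k q, ∀ z ∈ Φ.good, X k q z ≤ badWeight Ψ (η / 2) T c σ N Φ k q z + R k q z := by
    intro k q z hz
    by_cases hq : q ∈ cellBox (c * meanFreePath σ N)
    · rw [hR, if_pos hq, hX, if_pos hq]
      have hle : sInf ((fun z' => badWeight Ψ (η / 2) T c σ N Φ k q z') ''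
          (Φ.good ∩ {z' | seqHistLE b c σ N Φ k q z' = seqHistLE b c σ N Φ k q z})) ≤
          badWeight Ψ (η / 2) T c σ N Φ k q z := by
        refine csInf_le ⟨0, ?_⟩ ⟨z, ⟨hz, rfl⟩, rfl⟩
        rintro _ ⟨z', -, rfl⟩; exact (hbW (η / 2) k q z').1
      have hmax := le_max_right 0 (sSup ((fun z' => badWeight Ψ η T c σ N Φ k q z') ''
          (Φ.good ∩ {z' | seqHistLE b c σ N Φ k q z' = seqHistLE b c σ N Φ k q z})) -
        sInf ((fun z' => badWeight Ψ (η / 2) T c σ N Φ k q z') ''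
          (Φ.good ∩ {z' | seqHistLE b c σ N Φ k q z' = seqHistLE b c σ N Φ k q z})))
      linarith
    · rw [hX, if_neg hq, hR, if_neg hq]
      linarith [(hbW (η / 2) k q z).1]
  refine ⟨X, R, hXb, hRb, hX0, hR0, hXa, hRa, hdom, hsand, ?_⟩
  -- the mean of the remainder: pointwise domination on the good set by `RevealedDefectStability`'s integrand
  have hG0 : ∀ k, ∀ q ∉ cellBox (c * meanFreePath σ N), ∀ z,
      min (ownedCount c σ N Φ k q z) T * (if η / 4 < defectOsc Ψ b c σ N Φ k q z then (1 : ℝ) else 0) = 0 := by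
    intro k q hq z
    rw [ownedCount_eq_zero_of_not_mem hh Φ k hq z, min_eq_left hT.le, zero_mul]
  have hGnn : ∀ k q z, 0 ≤ min (ownedCount c σ N Φ k q z) T *
      (if η / 4 < defectOsc Ψ b c σ N Φ k q z then (1 : ℝ) else 0) := fun k q z =>
    mul_nonneg (le_min (ownedCount_nonneg hc.le hσ Φ k q z) hT.le) (by split_ifs <;> norm_num)
  have hRle : ∀ z ∈ Φ.good, ∀ k q, R k q z ≤ min (ownedCount c σ N Φ k q z) T *
      (if η / 4 < defectOsc Ψ b c σ N Φ k q z then (1 : ℝ) else 0) := by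
    intro z hz k q
    by_cases hq : q ∈ cellBox (c * meanFreePath σ N)
    · rw [hR, if_pos hq]
      exact revealedRemainder_le_integrand Φ hz hΨc hΨ hc hσ hσ2 b η hT.le k q
    · rw [hR, if_neg hq]
      exact hGnn k q z
  have hUle : ∀ z ∈ Φ.good, unitAvg c σ N τ (fun k q => R k q z) ≤ unitAvg c σ N τ (fun k q =>
      min (ownedCount c σ N Φ k q z) T * (if η / 4 < defectOsc Ψ b c σ N Φ k q z then (1 : ℝ) else 0)) :=
    fun z hz => unitAvg_mono hh.le (fun k q hq => by rw [hR0 k q hq]) (fun k q hq => hG0 k q hq z)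
      (fun k q => hRle z hz k q)
  have hU0 : ∀ z, 0 ≤ unitAvg c σ N τ (fun k q => R k q z) :=
    fun z => unitAvg_nonneg hh.le (fun k q hq => by rw [hR0 k q hq]) (fun k q => (hRb k q z).1)
  have hgood : ∀ᵐ z ∂μ, z ∈ Φ.good := mem_ae_iff.2 hμ
  unfold unitMean
  by_cases hI : Integrable (fun z => unitAvg c σ N τ fun k q => R k q z) μ
  · rw [integral_eq_lintegral_of_nonneg_ae (ae_of_all _ hU0) hI.aestronglyMeasurable]
    refine ENNReal.toReal_le_of_le_ofReal hδ ((lintegral_mono_ae ?_).trans hint)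
    filter_upwards [hgood] with z hz
    exact ENNReal.ofReal_le_ofReal (hUle z hz)
  · rw [integral_undef hI]
    exact hδ

end OneN

/-! ## The composition -/

/-- **Registered helper `revealedSandwich_of` (piece H4 of the forecast transfer S6): `RevealedDefectStability → RevealedSandwich`.**
Quantifiers: `σ₀ := min(σ₀ of RDS, 1/2)`; for `(σ, Φ, τ, Ψ, η, δ₄, T)` invoke `RevealedDefectStability` at `(Ψ, η/4, δ₄, T)` and
thread its `c₀`, `b₀(c)`, `N₀(b)` through verbatim; for `N ≥ N₀` the pair is `exists_revealedMajorant_remainder` for `Φ N` under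
`localGibbsLaw σ a₀ u₀ θ₀ N (Φ N)` (`goodᶜ` null, `localGibbsLaw_compl_good_eq_zero`). [folklore] -/
theorem revealedSandwich_of : RevealedDefectStability → RevealedSandwich := by
  intro h8 a₀ θ₀ u₀ ha hθ hu ha0 hθ0
  obtain ⟨σ₈, hσ₈, H8⟩ := h8 a₀ θ₀ u₀ ha hθ hu ha0 hθ0
  refine ⟨min σ₈ 2⁻¹, lt_min hσ₈ (by norm_num), ?_⟩
  intro σ hσ hσlt Φ τ hτ Ψ hΨ hΨb η δ₄ T hη hδ₄ hT
  have hσ₈' : σ < σ₈ := hσlt.trans_le (min_le_left _ _)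
  have hσ2 : σ < 2⁻¹ := hσlt.trans_le (min_le_right _ _)
  obtain ⟨CΨ, hC⟩ := hΨb
  obtain ⟨c₀, hc₀, H8c⟩ := H8 σ hσ hσ₈' Φ τ hτ Ψ hΨ ⟨CΨ, hC⟩ (η / 4) δ₄ T (by positivity) hδ₄ hT
  refine ⟨c₀, hc₀, fun c hc => ?_⟩
  obtain ⟨b₀, hb₀, H8b⟩ := H8c c hc
  refine ⟨b₀, hb₀, fun b hb hbb => ?_⟩
  obtain ⟨N₀, H8N⟩ := H8b b hb hbb
  refine ⟨N₀, fun N hN => ?_⟩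
  exact exists_revealedMajorant_remainder (Φ N) hσ hσ2 (hc₀.trans_le hc) b hΨ hC η hT τ (localGibbsLaw σ a₀ u₀ θ₀ N (Φ N))
    (localGibbsLaw_compl_good_eq_zero (Φ N)) hδ₄.le (H8N N hN)

end Summit.AtomisticToContinuum.HydrodynamicLimit.Theorems.EquilibriumForecastLine

end
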